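import Summits.Ventures.HodgeRepro2.T5BergmanHilbertSpace

/-!
# The `K`-type projector of the weighted Bergman model, on the space itself

For `f = Σ aₘ zᵐ ∈ A_k` the rotation subgroup `K = {rot u}` acts by `(π_k(rot u) f)(w) = u^{-k} f(ū² w)`,
with Fourier expansion `Σₘ aₘ u^{-(k+2m)} wᵐ` (`T5BergmanKTypes.hasSum_act_rot`). Integrating against the
character `u ↦ u^{k+2m}` over the normalised Haar measure of the circle isolates the `m`-th `K`-type:

  `∫_K u^{k+2m} (π_k(rot u) f)(w) du = aₘ wᵐ`   (`integral_circle_pow_mul_act_rot`)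

— the `K`-type projector `P_m f = aₘ zᵐ` of the model written out on the space (the abstract projector of
the compact-group lane, rows 111–117 of the p1 annex, made explicit), and `P_m` is the identity on the
monomial `zᵐ` and kills `zⁿ` for `n ≠ m` (`integral_circle_pow_mul_act_rot_monomial`).

Blind lane: Mathlib + the HodgeRepro2 prefix only; no sorry; axioms ⊆ {propext, Classical.choice,
Quot.sound}.
-/

namespace Summit.Ventures.HodgeRepro2.T5BergmanKTypeProjector

open MeasureTheory Metric Filter Topology
open T5SU11Unimodular T5SU11Fibration T5HaarCircle
open T5BergmanCoefficient T5BergmanKTypes T5CircleParseval T5BergmanCoefficientL2 T5BergmanParseval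

/-- `conj (u^p) = (u⁻¹)^p` on the circle. -/
lemma conj_pow (u : Circle) (p : ℕ) : (starRingEnd ℂ) ((u : ℂ) ^ p) = ((u : ℂ)⁻¹) ^ p := by
  rw [map_pow, ← Circle.coe_inv_eq_conj, Circle.coe_inv]

variable [MeasurableSpace Circle] [BorelSpace Circle]

/-- **Orthogonality of the characters**: `∫_K u^{k+2m} (u⁻¹)^{k+2j} du = δ_{mj}`. -/
lemma integral_pow_mul_inv_pow (k m j : ℕ) :
    ∫ u : Circle, (u : ℂ) ^ (k + 2 * m) * ((u : ℂ)⁻¹) ^ (k + 2 * j) ∂haarCircle =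
      if m = j then 1 else 0 := by
  have h := integral_zpow_mul_conj_zpow ((k + 2 * m : ℕ) : ℤ) ((k + 2 * j : ℕ) : ℤ)
  simp only [zpow_natCast, conj_pow, Nat.cast_inj] at h
  rw [h]
  have e : k + 2 * m = k + 2 * j ↔ m = j := by omega
  simp only [e]

omit [MeasurableSpace Circle] [BorelSpace Circle] in
/-- `u ↦ (u⁻¹)^p` is continuous on the circle. -/
lemma continuous_coe_inv_pow (p : ℕ) : Continuous fun u : Circle => ((u : ℂ)⁻¹) ^ p := by
  simp_rw [← Circle.coe_inv]
  exact ((by fun_prop : Continuous fun u : Circle => (u : ℂ)).comp continuous_inv).pow p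

/-- **The `K`-type projector on the space**: `∫_K u^{k+2m} (π_k(rot u) f)(w) du = aₘ wᵐ` for
`f = Σ aₙ zⁿ` on the disc and `w ∈ 𝔻`. -/
theorem integral_circle_pow_mul_act_rot (k m : ℕ) (a : ℕ → ℂ) (f : ℂ → ℂ)
    (hf : ∀ z ∈ ball (0 : ℂ) 1, HasSum (fun n => a n * z ^ n) (f z)) {w : ℂ}
    (hw : w ∈ ball (0 : ℂ) 1) :
    ∫ u : Circle, (u : ℂ) ^ (k + 2 * m) * act k (rot u) f w ∂haarCircle = a m * w ^ m := by
  -- the Fourier series of `u ↦ u^{k+2m} (π_k(rot u) f)(w)`, dominated by `Σ |aₙ| |w|ⁿ`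
  have hsum : Summable fun n => ‖a n‖ * ‖w‖ ^ n :=
    summable_norm_mul_pow a f hf (norm_nonneg w) (mem_ball_zero_iff.mp hw)
  set F : ℕ → Circle → ℂ := fun N u =>
    ∑ n ∈ Finset.range N, (u : ℂ) ^ (k + 2 * m) * ((((u : ℂ)⁻¹) ^ (k + 2 * n) * a n) * w ^ n) with hF
  have hpt : ∀ u : Circle, Tendsto (fun N => F N u) atTop
      (𝓝 ((u : ℂ) ^ (k + 2 * m) * act k (rot u) f w)) := by
    intro u
    have := ((hasSum_act_rot k u a f hf hw).mul_left ((u : ℂ) ^ (k + 2 * m))).tendsto_sum_nat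
    exact this
  have hbound : ∀ N u, ‖F N u‖ ≤ ∑' n, ‖a n‖ * ‖w‖ ^ n := by
    intro N u
    refine (norm_sum_le _ _).trans ?_
    refine (Finset.sum_le_sum fun n _ => ?_).trans (hsum.sum_le_tsum _ (fun n _ => by positivity))
    rw [norm_mul, norm_mul, norm_mul, norm_pow, norm_pow, norm_pow, norm_inv, Circle.norm_coe, inv_one,
      one_pow, one_pow, one_mul, one_mul]
  have hlim : Tendsto (fun N => ∫ u, F N u ∂haarCircle) atTop
      (𝓝 (∫ u : Circle, (u : ℂ) ^ (k + 2 * m) * act k (rot u) f w ∂haarCircle)) := by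
    refine tendsto_integral_of_dominated_convergence (fun _ => ∑' n, ‖a n‖ * ‖w‖ ^ n) (fun N => ?_)
      (integrable_const _) (fun N => Eventually.of_forall (hbound N)) (Eventually.of_forall hpt)
    refine (Continuous.aestronglyMeasurable ?_)
    rw [hF]
    refine continuous_finsetSum _ fun n _ => ?_
    exact ((by fun_prop : Continuous fun u : Circle => (u : ℂ) ^ (k + 2 * m)).mul
      (((continuous_coe_inv_pow (k + 2 * n)).mul continuous_const).mul continuous_const))
  -- the integrals of the partial sums are eventually `aₘ wᵐ`
  have hconst : Tendsto (fun N => ∫ u, F N u ∂haarCircle) atTop (𝓝 (a m * w ^ m)) := by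
    refine tendsto_const_nhds.congr' ?_
    filter_upwards [eventually_gt_atTop m] with N hN
    rw [hF]
    simp only
    rw [integral_finsetSum]
    · have e : ∀ n, ∫ u : Circle, (u : ℂ) ^ (k + 2 * m) * ((((u : ℂ)⁻¹) ^ (k + 2 * n) * a n) * w ^ n)
          ∂haarCircle = (a n * w ^ n) * (if m = n then 1 else 0) := by
        intro n
        rw [← integral_pow_mul_inv_pow k m n, mul_comm (a n * w ^ n), ← integral_mul_const]
        congr 1
        funext u
        ring
      simp_rw [e]
      rw [Finset.sum_eq_single m]
      · simp
      · intro n _ hnm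
        rw [if_neg (Ne.symm hnm), mul_zero]
      · intro hm
        exact absurd (Finset.mem_range.mpr hN) hm
    · intro n _
      exact ((by fun_prop : Continuous fun u : Circle => (u : ℂ) ^ (k + 2 * m)).mul
        (((continuous_coe_inv_pow (k + 2 * n)).mul continuous_const).mul
          continuous_const)).integrable_of_hasCompactSupport (HasCompactSupport.of_compactSpace _)
  exact tendsto_nhds_unique hlim hconst

/-- The projector on the monomials: `P_m zⁿ = δ_{mn} zⁿ`. -/
theorem integral_circle_pow_mul_act_rot_monomial (k m n : ℕ) {w : ℂ} (hw : w ∈ ball (0 : ℂ) 1) :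
    ∫ u : Circle, (u : ℂ) ^ (k + 2 * m) * act k (rot u) (fun z => z ^ n) w ∂haarCircle =
      if m = n then w ^ n else 0 := by
  have hf : ∀ z ∈ ball (0 : ℂ) 1, HasSum (fun j => (if j = n then (1 : ℂ) else 0) * z ^ j) (z ^ n) := by
    intro z _
    have := hasSum_ite_eq n (z ^ n)
    refine this.congr_fun fun j => ?_
    by_cases hj : j = n <;> simp [hj]
  rw [integral_circle_pow_mul_act_rot k m _ (fun z => z ^ n) hf hw]
  by_cases hmn : m = n <;> simp [hmn]

/-- The projector from a holomorphic `f` (Taylor coefficients). -/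
theorem integral_circle_pow_mul_act_rot_taylor (k m : ℕ) (f : ℂ → ℂ)
    (hf : DifferentiableOn ℂ f (ball 0 1)) {w : ℂ} (hw : w ∈ ball (0 : ℂ) 1) :
    ∫ u : Circle, (u : ℂ) ^ (k + 2 * m) * act k (rot u) f w ∂haarCircle = taylorCoeff f m * w ^ m :=
  integral_circle_pow_mul_act_rot k m _ f (hasSum_taylor f hf) hw

end Summit.Ventures.HodgeRepro2.T5BergmanKTypeProjector
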